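import Literature.MathematicalPhysics.QuantumFieldTheory.Balaban1983to89.B9Eq325ProjFormulaZd

/-!
# `Balaban1983to89.B9Eq325ProjFormulaZdLevels` — [Balaban1985BackgroundPropagators] (3.25) `R(U₀) = I − G′Q′*(Q′G′²Q′*)⁻¹Q′G′` ON HERMITIAN INPUTS
# WITH THE AVERAGED TRANSPORTERS UNITARY ONLY UP TO THE TRUNCATION LEVEL `m` — the hypothesis-exact edition of this seat's g2
# `B9Eq325ProjFormulaZd.projE_eq_Rop_of_herm` (which asked `Ū₀ʲ(Γ)` unitary at EVERY level `j`; only the levels `j ≤ m` that `Q′ = (Q′_j)_{j≤m}` reads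
# enter), so that it applies in [Balaban1985Averaging] Prop. 2's regime of a background small up to level `m`

statement-level skeleton of published theorems with citation tags; proofs where landed; nothing here is a claim about the
Yang–Mills mass gap

`[Balaban1985BackgroundPropagators]` ("B9", CMP **99** (1985) 389–434) p. 394 (3.25): *«R(U) = I − G′(U)Q′*(U)(Q′(U)G′(U)²Q′*(U))⁻¹Q′(U)G′(U)»*, with
(3.18)–(3.19) p. 393: *«Q′ … the sequence of averaging operations Q′_j(U) = Q′(Ūʲ⁻¹)…Q′(Ū)Q′(U), j = 0, 1, …»* up to the number of steps of the procedure —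
only the averaged configurations `Ūʲ`, `j` below the truncation, occur; `[Balaban1985Averaging]` Prop. 2 p. 26 gives their regularity (and, for unitary
groups, their unitarity: (42)–(43) keep `U(N)`-values in the small-field regime) exactly up to that level.  PDF held:
`paper:balaban1985-cmp99-background-propagators` pp. 393–394 (re-read by this seat, 2026-08-28).

CITATION HEADER (lean-in-tree rule).  Cell `pub-ymgap` (YM Track A, HUMAN RULING D-0062 ∕ D-0149 width push), DAG node N06 = [B9], width seat
`pub-ymgap-dag-n06-w4` (g3); a HYPOTHESIS-WEAKENING re-edition of this seat's own g2 file `B9Eq325ProjFormulaZd` (p600602), needed by the step-(ii)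
continuity road (`B9Thm311PosDefOpenZd`, p605686): there the background ranges over a small-field class controlling the averages `Ū₀ʲ` only for `j ≤ m`
(`B7Prop2Explicit.avgIter_mem`), so (3.25) must be available under `∀ j ≤ m, Ū₀ʲ(Γ) unitary`.  Every proof below is the g2 proof with the level bound
threaded through; the g2 lemmas not involving the transporters (`Rop`, `QprimeVec_GpZd_Rop`, `Rop_eq_indicator_covLap`, `deltaPrimeADom_of_ker`,
`formE_indicator_covLap_sub_Rop`, `star_transposeOn`, `covLap_starFun`) are cited BY NAME, nothing restated.

WHAT IS PROVED (kernel, 0 sorry; theorems only).  With `hT : ∀ j, j ≤ m → ∀ z y, bgT L U₀ j z y ∈ unitaryUnits 𝔸` in place of the all-levels hypothesis: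
`star_QprimeIter_le` · `starLev_QprimeVec_le` · `starSub_QprimeStar_le` · `deltaPrimeAZd_starFun_le` · `starSub_deltaPrimeADom_le` · `starSub_GpZd_le` ·
`starLev_qggq_le` · `starLev_cZd_le` · `starSub_Rop_le` · `isSelfAdjoint_lam0_le` · ★★★ `projE_eq_Rop_of_herm_le` ((3.25) for g0's `projE` on Hermitian
inputs: unitary `U₀`, `Ū₀ʲ(Γ)` unitary for `j ≤ m`, `a ≥ 0`, finite `Ω₀`, `0 < d`, `η ≠ 0`, `Q′*` injective, tracial Hermitian faithful `τ`).

HONEST SCOPE.  Algebra only (the same Lagrange-multiplier computation as g2, [Balaban1984PropagatorsI] (1.42)–(1.44)); no estimate; count-neutral; N05 ∕ N06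
NOT discharged; K1⁷ `stmt-QuantumFields-20542` NOT closed; one finite `𝕋⁴` programme at fixed `ε`, Bałaban as printed; R4 closes only the conditional
finite-`𝕋⁴` rung `BalabanLadder.UV` — nothing continuum ∕ ℝ⁴ ∕ OS ∕ mass gap ∕ Clay.  Unit `pub-ymgap-dag-n06-w4` (g3), 2026-08-28.
-/

noncomputable section

namespace Literature.MathematicalPhysics.QuantumFieldTheory.Balaban1983to89.B9Eq325ProjFormulaZdLevels

open B7Prop1Explicit B7Eq78Linearization
open B7Prop2Explicit (unitaryUnits)
open B8Eq119TwistedAxial (bgT)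
open B8Eq138LandauZd (covLap)
open B9Eq321LandauProjectionZd (suppSub formE projE rangeSub rangeGen gaugeNull indicator_mem_suppSub formE_apply formE_isSymm
  star_conjR_of_mem_unitaryUnits projE_eq_projection isCompl_rangeSub_orthogonal)
open B9Eq324DeltaPrimeAZd (single transposeOn QprimeLin QprimeLin_apply deltaPrimeAZd deltaPrimeAZd_apply deltaPrimeADom deltaPrimeADom_coe GpZd
  deltaPrimeADom_GpZd GpZd_deltaPrimeADom deltaPrimeADom_bijective formE_GpZd_symm)
open B9Eq325QGGQInvZd (levSupp QprimeVec QprimeVec_apply_of_mem QprimeStar QprimeStar_coe formE_qprimeStar qggq qggq_apply QprimeStarInjective cZd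
  qggq_cZd qggq_bijective)
open B9Eq325ProjFormulaZd (starFun starFun_apply starSub coe_starSub starLev star_transposeOn covLap_starFun Rop Rop_def QprimeVec_GpZd_Rop
  Rop_eq_indicator_covLap deltaPrimeADom_of_ker formE_indicator_covLap_sub_Rop)

-- `Site` alone could resolve to the torus sites of `Setup.lean`; re-export the `ℤ^d` sites of `B7Prop1Explicit`.
export B7Prop1Explicit (Site)

variable {d : ℕ} {𝔸 : Type*} [CStarAlgebra 𝔸]

/-! ## §1  `*`-compatibility of `Q′_j`, `Q′`, `Q′*`, `Δ′_a`, `G′`, `Q′G′²Q′*`, `(Q′G′²Q′*)⁻¹` with the transporters unitary up to level `m` -/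

section Compat

variable {L : ℕ} {U₀ : Site d → Fin d → 𝔸ˣ} (η : ℝ) (τ : 𝔸 →ₗ[ℂ] ℂ) {m : ℕ}

/-- **`Q′_j(U₀)(f*) = (Q′_j(U₀)f)*` for `j ≤ m`** when the averaged transporters `Ū₀ʲ'(Γ)` are unitary for `j' ≤ m` (each one-step average commutes with `*`).
[cite: Balaban1985BackgroundPropagators, (3.19) p.393; Balaban1985Averaging, Prop. 2 p.26] -/
theorem star_QprimeIter_le (hT : ∀ j, j ≤ m → ∀ (z y : Site d), bgT L U₀ j z y ∈ unitaryUnits 𝔸) (f : Site d → 𝔸) :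
    ∀ j, j ≤ m → ∀ (y : Site d), star (QprimeIter (zdBlocking d L) (bgT L U₀) j f y) = QprimeIter (zdBlocking d L) (bgT L U₀) j (starFun f) y := by
  intro j
  induction j with
  | zero => intro _ y; rfl
  | succ j ih =>
    intro hj y
    rw [QprimeIter_succ, QprimeIter_succ, Qprime, Qprime, star_sum]
    refine Finset.sum_congr rfl fun x _ => ?_
    rw [star_smul, star_trivial, star_conjR_of_mem_unitaryUnits (hT j (Nat.le_of_succ_le hj) y x), ih (Nat.le_of_succ_le hj) x]

variable [FiniteDimensional ℝ 𝔸] (hτp : ∀ a : 𝔸, a ≠ 0 → 0 < (τ (star a * a)).re) {Λ : ℕ → Finset (Site d)} {s : Finset (Site d)}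

omit [FiniteDimensional ℝ 𝔸] in
/-- **`Q′(f*) = (Q′f)*`** on `L²(Ω₀, ·) → L²(𝔅, ·)` (transporters unitary up to level `m`). [cite: Balaban1985BackgroundPropagators, (3.19) p.393] -/
theorem starLev_QprimeVec_le (hT : ∀ j, j ≤ m → ∀ (z y : Site d), bgT L U₀ j z y ∈ unitaryUnits 𝔸) (f : suppSub (𝔸 := 𝔸) s) :
    QprimeVec L U₀ m Λ s (starSub f) = starLev (QprimeVec L U₀ m Λ s f) := by
  classical
  apply Subtype.ext
  funext p
  show (if p.1 ∈ Finset.range (m + 1) ∧ p.2 ∈ Λ p.1 then QprimeIter (zdBlocking d L) (bgT L U₀) p.1 (starFun (f : Site d → 𝔸)) p.2 else 0) =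
    star (if p.1 ∈ Finset.range (m + 1) ∧ p.2 ∈ Λ p.1 then QprimeIter (zdBlocking d L) (bgT L U₀) p.1 (f : Site d → 𝔸) p.2 else 0)
  split_ifs with h
  · rw [star_QprimeIter_le hT _ p.1 (Nat.lt_succ_iff.1 (Finset.mem_range.1 h.1))]
  · rw [star_zero]

omit [FiniteDimensional ℝ 𝔸] in
/-- `Q′_j(U₀)` as a linear map commutes with `*` for `j ≤ m`. [cite: Balaban1985BackgroundPropagators, (3.19) p.393 (bookkeeping)] -/
theorem QprimeLin_starFun_le (hT : ∀ j, j ≤ m → ∀ (z y : Site d), bgT L U₀ j z y ∈ unitaryUnits 𝔸) {j : ℕ} (hj : j ≤ m) (g : Site d → 𝔸) :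
    QprimeLin L U₀ j (starFun g) = starFun (QprimeLin L U₀ j g) := by
  funext y
  rw [QprimeLin_apply, QprimeLin_apply, starFun_apply, star_QprimeIter_le hT g j hj y]

/-- **`Q′*(φ*) = (Q′*φ)*`** (transporters unitary up to level `m`). [cite: Balaban1985BackgroundPropagators, (3.25) p.394] -/
theorem starSub_QprimeStar_le (hτt : ∀ a b : 𝔸, τ (a * b) = τ (b * a)) (hτs : ∀ a : 𝔸, τ (star a) = starRingEnd ℂ (τ a))
    (hT : ∀ j, j ≤ m → ∀ (z y : Site d), bgT L U₀ j z y ∈ unitaryUnits 𝔸) (φ : levSupp (𝔸 := 𝔸) m Λ) :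
    QprimeStar L U₀ τ m Λ s hτp (starLev φ) = starSub (QprimeStar L U₀ τ m Λ s hτp φ) := by
  apply Subtype.ext
  rw [QprimeStar_coe, coe_starSub, QprimeStar_coe]
  funext x
  by_cases hx : x ∈ (↑s : Set (Site d))
  · rw [Set.indicator_of_mem hx, starFun_apply, Set.indicator_of_mem hx, Finset.sum_apply, Finset.sum_apply, star_sum]
    refine Finset.sum_congr rfl fun j hj => ?_
    rw [star_transposeOn τ hτp hτt hτs (QprimeLin L U₀ j) (QprimeLin_starFun_le hT (Nat.lt_succ_iff.1 (Finset.mem_range.1 hj))) (Λ j)]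
    rfl
  · rw [Set.indicator_of_notMem hx, starFun_apply, Set.indicator_of_notMem hx, star_zero]

variable {a : ℕ → ℝ}

/-- **`Δ′_a(U₀)(f*) = (Δ′_a(U₀)f)*`** (unitary `U₀`, transporters unitary up to level `m`). [cite: Balaban1985BackgroundPropagators, (3.24) p.394] -/
theorem deltaPrimeAZd_starFun_le (hτt : ∀ a b : 𝔸, τ (a * b) = τ (b * a)) (hτs : ∀ a : 𝔸, τ (star a) = starRingEnd ℂ (τ a))
    (hU : ∀ (x : Site d) (κ : Fin d), U₀ x κ ∈ unitaryUnits 𝔸) (hT : ∀ j, j ≤ m → ∀ (z y : Site d), bgT L U₀ j z y ∈ unitaryUnits 𝔸) (f : Site d → 𝔸) :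
    deltaPrimeAZd L U₀ η τ hτp m a Λ (starFun f) = starFun (deltaPrimeAZd L U₀ η τ hτp m a Λ f) := by
  funext x
  rw [deltaPrimeAZd_apply, starFun_apply, deltaPrimeAZd_apply, star_add, star_sum, covLap_starFun hU, starFun_apply]
  congr 1
  refine Finset.sum_congr rfl fun j hj => ?_
  have hjm : j ≤ m := Nat.lt_succ_iff.1 (Finset.mem_range.1 hj)
  rw [star_smul, star_trivial, star_transposeOn τ hτp hτt hτs (QprimeLin L U₀ j) (QprimeLin_starFun_le hT hjm) (Λ j)]
  congr 2
  have := QprimeLin_starFun_le hT hjm f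
  rw [QprimeLin_apply, QprimeLin_apply] at this
  exact this

/-- **`Ω₀Δ′_a(U₀)Ω₀` COMMUTES WITH THE INVOLUTION** (transporters unitary up to level `m`). [cite: Balaban1985BackgroundPropagators, (3.24) p.394] -/
theorem starSub_deltaPrimeADom_le (hτt : ∀ a b : 𝔸, τ (a * b) = τ (b * a)) (hτs : ∀ a : 𝔸, τ (star a) = starRingEnd ℂ (τ a))
    (hU : ∀ (x : Site d) (κ : Fin d), U₀ x κ ∈ unitaryUnits 𝔸) (hT : ∀ j, j ≤ m → ∀ (z y : Site d), bgT L U₀ j z y ∈ unitaryUnits 𝔸)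
    (f : suppSub (𝔸 := 𝔸) s) :
    deltaPrimeADom L U₀ η τ hτp m a Λ s (starSub f) = starSub (deltaPrimeADom L U₀ η τ hτp m a Λ s f) := by
  apply Subtype.ext
  rw [deltaPrimeADom_coe, coe_starSub, coe_starSub, deltaPrimeADom_coe, deltaPrimeAZd_starFun_le η τ hτp hτt hτs hU hT]
  funext x
  by_cases hx : x ∈ (↑s : Set (Site d))
  · rw [Set.indicator_of_mem hx, starFun_apply, starFun_apply, Set.indicator_of_mem hx]
  · rw [Set.indicator_of_notMem hx, starFun_apply, Set.indicator_of_notMem hx, star_zero]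

/-- ★ **`G′(U₀)(f*) = (G′(U₀)f)*`** (transporters unitary up to level `m`). [cite: Balaban1985BackgroundPropagators, (3.24)–(3.25) p.394] -/
theorem starSub_GpZd_le (hd : 0 < d) (hη : η ≠ 0) (hτt : ∀ a b : 𝔸, τ (a * b) = τ (b * a)) (hτs : ∀ a : 𝔸, τ (star a) = starRingEnd ℂ (τ a))
    (hU : ∀ (x : Site d) (κ : Fin d), U₀ x κ ∈ unitaryUnits 𝔸) (ha : ∀ j, 0 ≤ a j)
    (hT : ∀ j, j ≤ m → ∀ (z y : Site d), bgT L U₀ j z y ∈ unitaryUnits 𝔸) (f : suppSub (𝔸 := 𝔸) s) :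
    GpZd L U₀ η τ hτp m a Λ s hd hη hτt hτs hU ha (starSub f) = starSub (GpZd L U₀ η τ hτp m a Λ s hd hη hτt hτs hU ha f) := by
  apply (deltaPrimeADom_bijective L U₀ η τ hτp m a Λ s hd hη hτt hτs hU ha).1
  rw [deltaPrimeADom_GpZd hd hη hτt hτs hU ha, starSub_deltaPrimeADom_le η τ hτp hτt hτs hU hT, deltaPrimeADom_GpZd hd hη hτt hτs hU ha]

variable (hd : 0 < d) (hη : η ≠ 0) (hτt : ∀ a b : 𝔸, τ (a * b) = τ (b * a)) (hτs : ∀ a : 𝔸, τ (star a) = starRingEnd ℂ (τ a))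
  (hU : ∀ (x : Site d) (κ : Fin d), U₀ x κ ∈ unitaryUnits 𝔸) (ha : ∀ j, 0 ≤ a j)
  (hT : ∀ j, j ≤ m → ∀ (z y : Site d), bgT L U₀ j z y ∈ unitaryUnits 𝔸)

include hT in
/-- **`Q′G′²Q′*` COMMUTES WITH THE INVOLUTION** (transporters unitary up to level `m`). [cite: Balaban1985BackgroundPropagators, (3.25) p.394] -/
theorem starLev_qggq_le (φ : levSupp (𝔸 := 𝔸) m Λ) :
    qggq L U₀ η τ hτp m a Λ s hd hη hτt hτs hU ha (starLev φ) = starLev (qggq L U₀ η τ hτp m a Λ s hd hη hτt hτs hU ha φ) := by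
  rw [qggq_apply, qggq_apply, starSub_QprimeStar_le τ hτp hτt hτs hT, starSub_GpZd_le η τ hτp hd hη hτt hτs hU ha hT,
    starSub_GpZd_le η τ hτp hd hη hτt hτs hU ha hT, starLev_QprimeVec_le hT]

include hT in
/-- ★ **`(Q′G′²Q′*)⁻¹(φ*) = ((Q′G′²Q′*)⁻¹φ)*`** (transporters unitary up to level `m`). [cite: Balaban1985BackgroundPropagators, (3.25) p.394] -/
theorem starLev_cZd_le (hinj : QprimeStarInjective L U₀ τ hτp m Λ s) (φ : levSupp (𝔸 := 𝔸) m Λ) :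
    cZd L U₀ η τ hτp m a Λ s hd hη hτt hτs hU ha hinj (starLev φ) = starLev (cZd L U₀ η τ hτp m a Λ s hd hη hτt hτs hU ha hinj φ) := by
  apply (qggq_bijective L U₀ η τ hτp m a Λ s hd hη hτt hτs hU ha hinj).1
  rw [qggq_cZd, starLev_qggq_le η τ hτp hd hη hτt hτs hU ha hT, qggq_cZd]

end Compat

/-! ## §2  `R` commutes with the involution; `λ₀ = G′Rf` is Hermitian for Hermitian `f`; (3.25) on Hermitian inputs -/

section Formula

variable (L : ℕ) (U₀ : Site d → Fin d → 𝔸ˣ) (η : ℝ) (τ : 𝔸 →ₗ[ℂ] ℂ) [FiniteDimensional ℝ 𝔸]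
  (hτp : ∀ a : 𝔸, a ≠ 0 → 0 < (τ (star a * a)).re) (m : ℕ) (a : ℕ → ℝ) (Λ : ℕ → Finset (Site d)) (s : Finset (Site d))
  (hd : 0 < d) (hη : η ≠ 0) (hτt : ∀ a b : 𝔸, τ (a * b) = τ (b * a)) (hτs : ∀ a : 𝔸, τ (star a) = starRingEnd ℂ (τ a))
  (hU : ∀ (x : Site d) (κ : Fin d), U₀ x κ ∈ unitaryUnits 𝔸) (ha : ∀ j, 0 ≤ a j) (hinj : QprimeStarInjective L U₀ τ hτp m Λ s)
  (hT : ∀ j, j ≤ m → ∀ (z y : Site d), bgT L U₀ j z y ∈ unitaryUnits 𝔸)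

include hT in
/-- **`R(f*) = (Rf)*`** (unitary `U₀`, transporters unitary up to level `m`). [cite: Balaban1985BackgroundPropagators, (3.25) p.394] -/
theorem starSub_Rop_le (f : suppSub (𝔸 := 𝔸) s) :
    Rop L U₀ η τ hτp m a Λ s hd hη hτt hτs hU ha hinj (starSub f) = starSub (Rop L U₀ η τ hτp m a Λ s hd hη hτt hτs hU ha hinj f) := by
  rw [Rop_def, Rop_def, starSub_GpZd_le η τ hτp hd hη hτt hτs hU ha hT f, starLev_QprimeVec_le hT,
    starLev_cZd_le η τ hτp hd hη hτt hτs hU ha hT hinj, starSub_QprimeStar_le τ hτp hτt hτs hT, starSub_GpZd_le η τ hτp hd hη hτt hτs hU ha hT]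
  apply Subtype.ext
  funext x
  simp only [Submodule.coe_sub, Pi.sub_apply, coe_starSub, starFun_apply, star_sub]

include hT in
/-- **FOR A HERMITIAN `f`, `λ₀ := G′Rf` IS HERMITIAN-VALUED** (transporters unitary up to level `m`). [cite: Balaban1985BackgroundPropagators, (3.21)–(3.22) p.394 («L²(Ω₀, 𝔤)»)] -/
theorem isSelfAdjoint_lam0_le {f : suppSub (𝔸 := 𝔸) s} (hf : starSub f = f) (x : Site d) :
    IsSelfAdjoint
      (((GpZd L U₀ η τ hτp m a Λ s hd hη hτt hτs hU ha (Rop L U₀ η τ hτp m a Λ s hd hη hτt hτs hU ha hinj f) : suppSub (𝔸 := 𝔸) s) :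
        Site d → 𝔸) x) := by
  have h : starSub (GpZd L U₀ η τ hτp m a Λ s hd hη hτt hτs hU ha (Rop L U₀ η τ hτp m a Λ s hd hη hτt hτs hU ha hinj f)) =
      GpZd L U₀ η τ hτp m a Λ s hd hη hτt hτs hU ha (Rop L U₀ η τ hτp m a Λ s hd hη hτt hτs hU ha hinj f) := by
    rw [← starSub_GpZd_le η τ hτp hd hη hτt hτs hU ha hT, ← starSub_Rop_le L U₀ η τ hτp m a Λ s hd hη hτt hτs hU ha hinj hT, hf]
  have hx := congrArg (fun g : suppSub (𝔸 := 𝔸) s => (g : Site d → 𝔸) x) h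
  simp only [coe_starSub, starFun_apply] at hx
  exact hx

include hT in
/-- ★★★ **(3.25) FOR g0's `R(U₀)` ON HERMITIAN INPUTS, TRANSPORTERS UNITARY UP TO LEVEL `m`**: for `f ∈ L²(Ω₀, ·)` Hermitian-valued, at every UNITARY background
`U₀` whose averaged transporters `Ū₀ʲ(Γ)`, `j ≤ m`, are unitary ([Balaban1985Averaging] Prop. 2's regime up to the truncation), tracial Hermitian faithful `τ` on a
finite-dimensional `𝔸`, ANY `a ≥ 0`, finite `Ω₀`, `0 < d`, `η ≠ 0`, `Q′*` injective: `R(U₀)f = f − G′(Q′*((Q′G′²Q′*)⁻¹(Q′(G′f))))` — the orthogonal projection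
`projE` of (3.21)–(3.22) IS print's Lagrange-multiplier formula (the g2 proof, with `isSelfAdjoint_lam0_le`). [cite: Balaban1985BackgroundPropagators, (3.25) p.394, (3.21)–(3.22) p.394; Balaban1984PropagatorsI, (1.42)–(1.44) p.25] -/
theorem projE_eq_Rop_of_herm_le {f : suppSub (𝔸 := 𝔸) s} (hf : starSub f = f) :
    projE τ s L m η (fun j => (↑(Λ j) : Set (Site d))) U₀ f = Rop L U₀ η τ hτp m a Λ s hd hη hτt hτs hU ha hinj f := by
  set R := Rop L U₀ η τ hτp m a Λ s hd hη hτt hτs hU ha hinj f with hRdef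
  set lam := GpZd L U₀ η τ hτp m a Λ s hd hη hτt hτs hU ha R with hlam
  have hc := isCompl_rangeSub_orthogonal (s := s) (τ := τ) L m η (fun j => (↑(Λ j) : Set (Site d))) U₀ hτs hτp
  -- (i) `Rf ∈ Δ^η_{U₀}N_𝔤(Q′)`
  have hker : ∀ j ∈ Finset.range (m + 1), ∀ y ∈ Λ j, QprimeIter (zdBlocking d L) (bgT L U₀) j (lam : Site d → 𝔸) y = 0 := by
    intro j hj y hy
    have h := congrArg (fun φ : levSupp (𝔸 := 𝔸) m Λ => (φ : ℕ × Site d → 𝔸) (j, y)) (QprimeVec_GpZd_Rop L U₀ η τ hτp m a Λ s hd hη hτt hτs hU ha hinj f)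
    simp only [Submodule.coe_zero, Pi.zero_apply] at h
    rwa [QprimeVec_apply_of_mem L U₀ m Λ s _ hj hy] at h
  have hmem : R ∈ rangeSub s L m η (fun j => (↑(Λ j) : Set (Site d))) U₀ := by
    refine Submodule.subset_span ⟨(lam : Site d → 𝔸), ⟨?_, fun x hx => lam.2 x hx, ?_⟩, ?_⟩
    · exact fun x => isSelfAdjoint_lam0_le L U₀ η τ hτp m a Λ s hd hη hτt hτs hU ha hinj hT hf x
    · intro j hj y hy
      exact hker j (Finset.mem_range.2 (Nat.lt_succ_of_le hj)) y (Finset.mem_coe.1 hy)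
    · exact Rop_eq_indicator_covLap L U₀ η τ hτp m a Λ s hd hη hτt hτs hU ha hinj f
  -- (ii) `f − Rf ⊥ Δ^η_{U₀}N_𝔤(Q′)`
  have horth : f - R ∈ (formE τ s).orthogonal (rangeSub s L m η (fun j => (↑(Λ j) : Set (Site d))) U₀) := by
    rw [LinearMap.BilinForm.mem_orthogonal_iff]
    intro w hw
    induction hw using Submodule.span_induction with
    | mem w hw =>
      obtain ⟨mu, ⟨_, hsupp, hQ⟩, hwmu⟩ := hw
      have hker' : ∀ j ∈ Finset.range (m + 1), ∀ y ∈ Λ j, QprimeIter (zdBlocking d L) (bgT L U₀) j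
          (((⟨mu, hsupp⟩ : suppSub (𝔸 := 𝔸) s) : suppSub (𝔸 := 𝔸) s) : Site d → 𝔸) y = 0 :=
        fun j hj y hy => hQ j (Nat.le_of_lt_succ (Finset.mem_range.1 hj)) y (Finset.mem_coe.2 hy)
      have hw' : w = deltaPrimeADom L U₀ η τ hτp m a Λ s ⟨mu, hsupp⟩ :=
        Subtype.ext (by rw [hwmu, deltaPrimeADom_of_ker L U₀ η τ hτp m a Λ s ⟨mu, hsupp⟩ hker'])
      show formE τ s w (f - R) = 0
      rw [hw']
      exact formE_indicator_covLap_sub_Rop L U₀ η τ hτp m a Λ s hd hη hτt hτs hU ha hinj ⟨mu, hsupp⟩ hker' f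
    | zero =>
      show formE τ s 0 (f - R) = 0
      rw [map_zero, LinearMap.zero_apply]
    | add w₁ w₂ _ _ h₁ h₂ =>
      show formE τ s (w₁ + w₂) (f - R) = 0
      have e₁ : formE τ s w₁ (f - R) = 0 := h₁
      have e₂ : formE τ s w₂ (f - R) = 0 := h₂
      rw [map_add, LinearMap.add_apply, e₁, e₂, add_zero]
    | smul c w _ hw =>
      show formE τ s (c • w) (f - R) = 0
      have e : formE τ s w (f - R) = 0 := hw
      rw [map_smul, LinearMap.smul_apply, e, smul_zero]
  -- (iii) uniqueness of the orthogonal decomposition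
  rw [projE_eq_projection L m η _ U₀ hτs hτp]
  have hsplit : f = R + (f - R) := by abel
  conv_lhs => rw [hsplit]
  rw [map_add, Submodule.projection_apply_of_mem_left _ hmem, Submodule.projection_apply_of_mem_right _ horth, add_zero]

end Formula

end Literature.MathematicalPhysics.QuantumFieldTheory.Balaban1983to89.B9Eq325ProjFormulaZdLevels

end
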